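import Literature.Probability.RandomPlanarGeometry.HexSAWArmchairSqrtStrict
import Literature.Probability.RandomPlanarGeometry.HexSAWArmchairSqrtAsymptotic
import Literature.Probability.RandomPlanarGeometry.HexSAWRotSurfaceArmchairDictionary
import Literature.Probability.RandomPlanarGeometry.HexSAWSurfaceWallBridges
import HarnessLib

/-!
# Beaton's rotated surface model: `√y < μ(y) ≤ √y · μ` for `y ≥ 1`, `μ(y) = μ` for `0 < y ≤ 1`, and `β_rot(y) ≤ √(max(1,y)) · μ` for
# every `y > 0` — WITHOUT the door (no limit theorem is used)

Topic `Literature/Probability/RandomPlanarGeometry` (lane «pcv-sawmu», rotated-door lineage, rider G «ROT-SQRT-UPPER», EDITION 2 re-founded on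
SERVED parents: `HexSAWArmchairWallBridges.lean` (A6: `hp`, `wb`, `WB`, `visits`, `armRate`), `HexSAWArmchairSqrtAsymptotic.lean`
(`armRate_le_of_WB_le` — Fekete comparison), `HexSAWArmchairSqrtStrict.lean` (`sqrt_lt_armRate`), `HexSAWRotSurfaceArmchairDictionary.lean`
(`rotSurfaceMu y = max (armRate y) μ`, `rotHpCoeff (n+1) y = Cw n y`), `HexSAWSurfaceWallBridges.lean` (`Wall.eventually_mul_exp_sqrt_le_pow`,
the sub-exponential Hammersley–Welsh factor) — ed.1 6ccadcfdacc888ed reached the same headline through the door `HexSAWRotSurfaceYcLimitAllY`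
and rider E; this edition needs neither).

Sources.  N. R. Beaton, J. Phys. A 47 (2014) 075003 = arXiv:1210.0274v3, §3.1, Proposition 7 (p. 11: "For `0 < y ≤ 1`, `μ(y) = μ(1) = μ`, where
`μ = √(2+√2)` is the growth constant of SAWs on the honeycomb lattice. Moreover, for any `y > 0`, `μ(y) ≥ max{μ, √y}`. This implies the
existence of a critical value `y_c`, with `1 ≤ y_c ≤ μ²`"; `μ = 1/x_c` in the tree's dictionary), §2 (Fig. 1: the armchair surface).  J. M. Hammersley, D. J. A. Welsh, Quart. J. Math. 13 (1962) 108 (`c_n ≤ μ^n e^{O(√n)}`; tree file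
`HexSAWHammersleyWelshSix`).  N. Madras, G. Slade, *The Self-Avoiding Walk* (1993), §1.2 (Lemma 1.2.2, (1.2.17)).  I. G. Enting, I. Jensen,
LNP 775 (2009), §7.4.2 (Fig. 7.10: brickwork form of the honeycomb lattice).

What is proved (namespaces `…SAW.HexBW.Arm` / `…SAW.HV`; no hypotheses beyond the sign of `y`):

* lattice combinatorics of the armchair wall (from ed.1): `no_three_walls`, `no_wall_wall_gap_wall`, `no_wall_gap_wall_wall`,
  `visits_window_le_two`, **`visits_le_half : visits m ω ≤ m/2 + 2`** on half-plane walks, `Cw_le_pow_mul`;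
* `WB_le_pow_half_mul_card : B^w_n(y) ≤ max(1,y)^{n/2+2} · c_n(ℍ)`, `WB_le_mul_pow_of_one_lt` (for every `s > 1` a uniform bound
  `B^w_n(y) ≤ M · (s √max(1,y) μ)^n`, Hammersley–Welsh), hence by the Fekete comparison **`armRate_le_sqrt_max_mul (0 < y) :
  β_rot(y) ≤ √(max(1,y)) · μ`**, `armRate_le_sqrt_mul (1 ≤ y) : β_rot(y) ≤ √y · μ`, `armRate_le_hexConnectiveConstant_of_le_one (0 < y ≤ 1) :
  β_rot(y) ≤ μ`;
* in the dictionary form `rotSurfaceMu y = max (armRate y) μ` of Beaton's `μ(y)`: **`HV.rotSurfaceMu_eq_of_le_one (0 < y ≤ 1) : μ(y) = μ`**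
  (the printed clause "for `0 < y ≤ 1`, `μ(y) = μ`", here door-free), **`HV.rotSurfaceMu_le_sqrt_mul (1 ≤ y) : μ(y) ≤ √y · μ`**,
  `rotSurfaceMu_le_sqrt_max_mul`, `HV.sqrt_lt_rotSurfaceMu (0 < y) : √y < μ(y)` (strict form of the printed `μ(y) ≥ √y`, from the tree's
  `√y < β_rot(y)`), `sqrt_lt_rotSurfaceMu_le (1 ≤ y) : √y < μ(y) ≤ √y · μ`, and `rotHpCoeff_le_pow_half_mul : C⁺_n(y) ≤ y^{(n−1)/2+2} C⁺_n(1)`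
  (`y ≥ 1`).

Status in print / LABEL (author's proposal): "for `0 < y ≤ 1`, `μ(y) = μ`" and "`y_c ≤ μ²`" are PRINTED (Prop. 7); the explicit window
`√y < μ(y) ≤ √y·μ` (all `y ≥ 1`) and the density-`½` mechanism behind it (at most every other vertex of an armchair walk lies on the wall,
up to 2) are the rotated-frame counterpart of BBdGDCG's remark "μ(y) ∼ √y" — CONSOLIDATION of printed clauses + lane corollary XS; nothing
here is claimed new beyond writing.
EDITIONS: ed.1 6ccadcfdacc888ed (212 l; imports rider E → door D; custody a-idea-2 g22); ed.2 (this): the `…SAW.HexBW.Arm` section of ed.1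
verbatim + a door-free route (`WB` ≤ Hammersley–Welsh ⇒ Fekete) replacing ed.1's limit argument (`rotSurfaceMu_le_of_eventually_le` dropped,
`sqrt_le_rotSurfaceMu_le` replaced by the strict `sqrt_lt_rotSurfaceMu_le`, `armRate_le_sqrt_mul` moved to namespace `Arm`; NEW:
`WB_le_pow_half_mul_card`, `WB_le_mul_pow_of_one_lt`, `armRate_le_sqrt_max_mul`, `armRate_le_hexConnectiveConstant_of_le_one`,
`rotSurfaceMu_le_sqrt_max_mul`, `rotSurfaceMu_eq_of_le_one`, `sqrt_lt_rotSurfaceMu`); ed.3 = ed.2 with the Prop. 7 clause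
re-quoted VERBATIM from the held TeX («μ(y) = μ(1) = μ, where μ = √(2+√2) …»; ref g44 03:57:16Z) at four docstring places — DOCSTRING-ONLY,
code byte-identical; ed.4 = ed.3 ⊕ the appended two-theorem section «`μ < β_rot(y)`, `μ < μ(y)` for `y > μ²`» (Beaton's one-line argument for
`y_c ≤ μ²`, door-free).
-/

noncomputable section

open Finset Filter Function
open Literature.Probability.LatticeModels Literature.Probability.Percolation SimpleGraph
open _root_.Topology

namespace Literature.Probability.RandomPlanarGeometry.SAW.HexBW.Arm

variable {y : ℝ} {n : ℕ} {ω : ℕ → Site 2}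

/-! ### At most two wall vertices in any four consecutive times -/

/-- No three consecutive wall vertices (two dimer steps in a row would need both parities). [cite: EntingJensen2009, §7.4.2, Fig. 7.10 (brickwork form); Beaton2014RotatedHoneycomb, §2 (Fig. 1: the armchair surface)] -/
theorem no_three_walls (hω : ω ∈ hp n) {i : ℕ} (hi : i + 2 ≤ n) : ¬ (ω i 0 = 0 ∧ ω (i + 1) 0 = 0 ∧ ω (i + 2) 0 = 0) := by
  obtain ⟨hs, -⟩ := mem_hp.1 hω
  obtain ⟨-, -, hbw, hinj⟩ := mem_saws_iff.1 hs
  rintro ⟨h0, h1, h2⟩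
  have s1 := step_cases (hbw i (by omega))
  have s2 := step_cases (hbw (i + 1) (by omega))
  rw [show i + 1 + 1 = i + 2 by omega] at s2
  -- both steps are vertical (X fixed at 0); the parities clash unless the walk returns: then `ω i = ω (i+2)`
  have hne : ω i ≠ ω (i + 2) := fun e => by
    have := hinj (show i ∈ {j | j ≤ n} by simp; omega) (show i + 2 ∈ {j | j ≤ n} by simp; omega) e; omega
  rw [Ne, site_two_eq_iff] at hne
  omega

/-- After a dimer the walk leaves the wall for at least two steps: no pattern wall–wall–off–wall. [cite: EntingJensen2009, §7.4.2, Fig. 7.10; Beaton2014RotatedHoneycomb, §2 (Fig. 1)] -/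
theorem no_wall_wall_gap_wall (hω : ω ∈ hp n) {i : ℕ} (hi : i + 3 ≤ n) : ¬ (ω i 0 = 0 ∧ ω (i + 1) 0 = 0 ∧ ω (i + 3) 0 = 0) := by
  obtain ⟨hs, hH⟩ := mem_hp.1 hω
  obtain ⟨-, -, hbw, hinj⟩ := mem_saws_iff.1 hs
  rintro ⟨h0, h1, h3⟩
  by_cases h2 : ω (i + 2) 0 = 0
  · exact no_three_walls hω (show i + 2 ≤ n by omega) ⟨h0, h1, h2⟩
  · -- `ω (i+2) = (1, Y_{i+1})` and `ω (i+3)` on the wall is its horizontal neighbour `(0, Y_{i+1}) = ω (i+1)`: a revisit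
    have s2 := step_cases (hbw (i + 1) (by omega))
    have s3 := step_cases (hbw (i + 2) (by omega))
    rw [show i + 1 + 1 = i + 2 by omega] at s2
    rw [show i + 2 + 1 = i + 3 by omega] at s3
    have hX2 := hH (i + 2) (by omega)
    have hne : ω (i + 1) ≠ ω (i + 3) := fun e => by
      have := hinj (show i + 1 ∈ {j | j ≤ n} by simp; omega) (show i + 3 ∈ {j | j ≤ n} by simp; omega) e; omega
    rw [Ne, site_two_eq_iff] at hne
    omega

/-- Symmetrically: no pattern wall–off–wall–wall. [cite: EntingJensen2009, §7.4.2, Fig. 7.10; Beaton2014RotatedHoneycomb, §2 (Fig. 1)] -/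
theorem no_wall_gap_wall_wall (hω : ω ∈ hp n) {i : ℕ} (hi : i + 3 ≤ n) : ¬ (ω i 0 = 0 ∧ ω (i + 2) 0 = 0 ∧ ω (i + 3) 0 = 0) := by
  obtain ⟨hs, hH⟩ := mem_hp.1 hω
  obtain ⟨-, -, hbw, hinj⟩ := mem_saws_iff.1 hs
  rintro ⟨h0, h2, h3⟩
  by_cases h1 : ω (i + 1) 0 = 0
  · exact no_three_walls hω (show i + 1 + 2 ≤ n by omega) ⟨h1, by rw [show i + 1 + 1 = i + 2 by omega]; exact h2,
      by rw [show i + 1 + 2 = i + 3 by omega]; exact h3⟩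
  · have s1 := step_cases (hbw i (by omega))
    have s2 := step_cases (hbw (i + 1) (by omega))
    rw [show i + 1 + 1 = i + 2 by omega] at s2
    have hX1 := hH (i + 1) (by omega)
    have hne : ω i ≠ ω (i + 2) := fun e => by
      have := hinj (show i ∈ {j | j ≤ n} by simp; omega) (show i + 2 ∈ {j | j ≤ n} by simp; omega) e; omega
    rw [Ne, site_two_eq_iff] at hne
    omega

/-- **Any four consecutive times carry at most two wall vertices**: `visits (i+4) ≤ visits i + 2`. [cite: Beaton2014RotatedHoneycomb, §2 (Fig. 1: the armchair surface) and §3.1 (p. 11: surface vertices)] -/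
theorem visits_window_le_two (hω : ω ∈ hp n) {i : ℕ} (hi : i + 4 ≤ n) : visits (i + 4) ω ≤ visits i ω + 2 := by
  have e1 : visits (i + 1) ω = visits i ω + (if ω (i + 1) 0 = 0 then 1 else 0) := visits_succ i ω
  have e2 : visits (i + 2) ω = visits (i + 1) ω + (if ω (i + 2) 0 = 0 then 1 else 0) := visits_succ (i + 1) ω
  have e3 : visits (i + 3) ω = visits (i + 2) ω + (if ω (i + 3) 0 = 0 then 1 else 0) := visits_succ (i + 2) ω
  have e4 : visits (i + 4) ω = visits (i + 3) ω + (if ω (i + 4) 0 = 0 then 1 else 0) := visits_succ (i + 3) ω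
  have h3a := no_three_walls hω (i := i + 1) (by omega)
  have h3b := no_three_walls hω (i := i + 2) (by omega)
  have hA := no_wall_wall_gap_wall hω (i := i + 1) (by omega)
  have hB := no_wall_gap_wall_wall hω (i := i + 1) (by omega)
  simp only [add_assoc, Nat.reduceAdd] at h3a h3b hA hB
  rw [e4, e3, e2, e1]
  split_ifs <;> omega

/-- **At most half of the vertices (plus two) are on the armchair wall**: `visits n ω ≤ n/2 + 2`. [cite: Beaton2014RotatedHoneycomb, §2 (Fig. 1) and Proposition 7 (arXiv v3 p. 11: "1 ≤ y_c ≤ μ²")] -/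
theorem visits_le_half (hω : ω ∈ hp n) : ∀ m ≤ n, visits m ω ≤ m / 2 + 2 := by
  intro m
  induction m using Nat.strong_induction_on with
  | _ m ih =>
    intro hm
    rcases Nat.lt_or_ge m 4 with h4 | h4
    · rcases Nat.lt_or_ge m 3 with h3 | h3
      · have := visits_le m ω; omega
      · have hm3 : m = 3 := by omega
        subst hm3
        have v0 : visits 0 ω = if ω 0 0 = 0 then 1 else 0 := visits_zero ω
        have e1 : visits 1 ω = visits 0 ω + (if ω 1 0 = 0 then 1 else 0) := visits_succ 0 ω
        have e2 : visits 2 ω = visits 1 ω + (if ω 2 0 = 0 then 1 else 0) := visits_succ 1 ω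
        have e3 : visits 3 ω = visits 2 ω + (if ω 3 0 = 0 then 1 else 0) := visits_succ 2 ω
        have h3 := no_three_walls hω (i := 0) (by omega)
        simp only [zero_add] at h3
        rw [e3, e2, e1, v0]
        split_ifs <;> omega
    · obtain ⟨k, rfl⟩ : ∃ k, m = k + 4 := ⟨m - 4, by omega⟩
      have := ih k (by omega) (by omega)
      have := visits_window_le_two hω hm
      omega

/-- **`C^w_n(y) ≤ y^{n/2+2} · C^w_n(1)`** for `y ≥ 1`. [cite: Beaton2014RotatedHoneycomb, Proposition 7 (arXiv v3 p. 11: "1 ≤ y_c ≤ μ²")] -/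
theorem Cw_le_pow_mul (hy : 1 ≤ y) (n : ℕ) : Cw n y ≤ y ^ (n / 2 + 2) * Cw n 1 := by
  rw [Cw, Cw, Finset.mul_sum]
  refine Finset.sum_le_sum fun ω hω => ?_
  rw [one_pow, mul_one]
  exact pow_le_pow_right₀ hy (visits_le_half hω n le_rfl)


/-! ### Hammersley–Welsh on the wall bridges and the Fekete comparison: `β_rot(y) ≤ √(max(1,y)) · μ` -/

/-- **`B^w_n(y) ≤ max(1,y)^{n/2+2} · c_n(ℍ)`** (`y ≥ 0`): weight at most `max(1,y)^{visits}` with `visits ≤ n/2 + 2`, and `wb n ⊆ saws n`.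
[cite: Beaton2014RotatedHoneycomb, §3.1, Proposition 7 (arXiv v3 p. 11: "1 ≤ y_c ≤ μ²"); MadrasSlade1993, §1.2, (1.2.17)] -/
theorem WB_le_pow_half_mul_card (hy : 0 ≤ y) (n : ℕ) : WB n y ≤ max 1 y ^ (n / 2 + 2) * #(saws n) := by
  calc WB n y ≤ ∑ ω ∈ wb n, max 1 y ^ (n / 2 + 2) := Finset.sum_le_sum fun ω hω => by
        calc y ^ visits n ω ≤ max 1 y ^ visits n ω := pow_le_pow_left₀ hy (le_max_right _ _) _
          _ ≤ max 1 y ^ (n / 2 + 2) :=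
            pow_le_pow_right₀ (le_max_left _ _) (visits_le_half (arches_subset (wb_subset hω)) n le_rfl)
    _ = #(wb n) * max 1 y ^ (n / 2 + 2) := by rw [Finset.sum_const, nsmul_eq_mul]
    _ ≤ #(saws n) * max 1 y ^ (n / 2 + 2) := by
        gcongr
        exact (wb_subset.trans arches_subset).trans hp_subset
    _ = max 1 y ^ (n / 2 + 2) * #(saws n) := mul_comm _ _

/-- **Uniform exponential bound**: for every `s > 1` there is `M > 0` with `B^w_n(y) ≤ M · (s · √(max(1,y)) · μ)^n` for ALL `n`
(Hammersley–Welsh `c_n ≤ μ e^{6√n} μ^n`, the factor `e^{6√n}` absorbed into `s^n`).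
[cite: HammersleyWelsh1962, Theorem; MadrasSlade1993, §1.2, Lemma 1.2.2 (boundedness hypothesis)] -/
theorem WB_le_mul_pow_of_one_lt (hy : 0 < y) {s : ℝ} (hs : 1 < s) :
    ∃ M : ℝ, 0 < M ∧ ∀ n : ℕ, WB n y ≤ M * (s * (Real.sqrt (max 1 y) * hexConnectiveConstant)) ^ n := by
  set Y := max 1 y with hY
  set q := Real.sqrt Y with hq
  have hμ := hexConnectiveConstant_pos
  have hY1 : 1 ≤ Y := le_max_left _ _
  have hY0 : 0 < Y := lt_of_lt_of_le one_pos hY1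
  have hq1 : 1 ≤ q := by rw [hq, ← Real.sqrt_one]; exact Real.sqrt_le_sqrt hY1
  have hq2 : q ^ 2 = Y := Real.sq_sqrt hY0.le
  obtain ⟨N, hN⟩ := eventually_atTop.1 (Wall.eventually_mul_exp_sqrt_le_pow hs 1 6)
  refine ⟨Y ^ 2 * hexConnectiveConstant * Real.exp (6 * Real.sqrt N), by positivity, fun n => ?_⟩
  have h1 := WB_le_pow_half_mul_card hy.le n
  have h2 : (#(saws n) : ℝ) ≤ hexConnectiveConstant * Real.exp (6 * Real.sqrt n) * hexConnectiveConstant ^ n := by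
    rw [card_saws]; exact hexSawCount_le_mu_mul_exp_mul_pow n
  have h3 : Y ^ (n / 2) ≤ q ^ n :=
    calc Y ^ (n / 2) = q ^ (2 * (n / 2)) := by rw [pow_mul, hq2]
      _ ≤ q ^ n := pow_le_pow_right₀ hq1 (by omega)
  have h4 : Real.exp (6 * Real.sqrt n) ≤ Real.exp (6 * Real.sqrt N) * s ^ n := by
    rcases le_or_gt N n with hle | hlt
    · have h := hN n hle
      rw [one_mul] at h
      exact h.trans (le_mul_of_one_le_left (pow_nonneg (zero_le_one.trans hs.le) n) (Real.one_le_exp (by positivity)))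
    · have hle : Real.sqrt n ≤ Real.sqrt N := Real.sqrt_le_sqrt (by exact_mod_cast hlt.le)
      calc Real.exp (6 * Real.sqrt n) ≤ Real.exp (6 * Real.sqrt N) := Real.exp_le_exp.2 (by linarith)
        _ ≤ Real.exp (6 * Real.sqrt N) * s ^ n := le_mul_of_one_le_right (Real.exp_pos _).le (one_le_pow₀ hs.le)
  have hμn : 0 ≤ hexConnectiveConstant ^ n := pow_nonneg hμ.le n
  calc WB n y ≤ Y ^ (n / 2 + 2) * #(saws n) := h1
    _ ≤ Y ^ (n / 2 + 2) * (hexConnectiveConstant * Real.exp (6 * Real.sqrt n) * hexConnectiveConstant ^ n) :=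
        mul_le_mul_of_nonneg_left h2 (by positivity)
    _ = Y ^ 2 * hexConnectiveConstant * (Y ^ (n / 2) * Real.exp (6 * Real.sqrt n) * hexConnectiveConstant ^ n) := by ring
    _ ≤ Y ^ 2 * hexConnectiveConstant * (q ^ n * (Real.exp (6 * Real.sqrt N) * s ^ n) * hexConnectiveConstant ^ n) := by
        gcongr
    _ = Y ^ 2 * hexConnectiveConstant * Real.exp (6 * Real.sqrt N) * (s * (q * hexConnectiveConstant)) ^ n := by
        rw [mul_pow, mul_pow]; ring

/-- **`β_rot(y) ≤ √(max(1,y)) · μ` for every `y > 0`** (Fekete comparison `armRate_le_of_WB_le` on the uniform bound, then `s ↓ 1`).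
[cite: Beaton2014RotatedHoneycomb, §3.1, Proposition 7 (arXiv v3 p. 11: "1 ≤ y_c ≤ μ²"); MadrasSlade1993, §1.2, (1.2.17)] -/
theorem armRate_le_sqrt_max_mul (hy : 0 < y) : armRate y ≤ Real.sqrt (max 1 y) * hexConnectiveConstant := by
  set L := Real.sqrt (max 1 y) * hexConnectiveConstant with hL
  have hμ := hexConnectiveConstant_pos
  have hL0 : 0 < L := mul_pos (Real.sqrt_pos.2 (lt_of_lt_of_le one_pos (le_max_left _ _))) hμ
  refine le_of_forall_pos_le_add fun ε hε => ?_
  have hs : 1 < 1 + ε / L := by linarith [div_pos hε hL0]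
  obtain ⟨M, hM, h⟩ := WB_le_mul_pow_of_one_lt hy hs
  have key := armRate_le_of_WB_le hy hM (by positivity) h
  calc armRate y ≤ (1 + ε / L) * L := key
    _ = L + ε := by field_simp

/-- **`β_rot(y) ≤ √y · μ` for `y ≥ 1`.** [cite: Beaton2014RotatedHoneycomb, §3.1, Proposition 7 (arXiv v3 p. 11: "1 ≤ y_c ≤ μ²")] -/
theorem armRate_le_sqrt_mul (hy : 1 ≤ y) : armRate y ≤ Real.sqrt y * hexConnectiveConstant := by
  have h := armRate_le_sqrt_max_mul (lt_of_lt_of_le one_pos hy)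
  rwa [max_eq_right hy] at h

/-- **`β_rot(y) ≤ μ` for `0 < y ≤ 1`.** [cite: Beaton2014RotatedHoneycomb, §3.1, Proposition 7 (arXiv p. 11: "For 0 < y ≤ 1, μ(y) = μ(1) = μ")] -/
theorem armRate_le_hexConnectiveConstant_of_le_one (hy : 0 < y) (h1 : y ≤ 1) : armRate y ≤ hexConnectiveConstant := by
  have h := armRate_le_sqrt_max_mul hy
  rwa [max_eq_left h1, Real.sqrt_one, one_mul] at h

end Literature.Probability.RandomPlanarGeometry.SAW.HexBW.Arm

/-! ### Beaton's `μ(y)` in the dictionary form `rotSurfaceMu y = max (armRate y) μ` -/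

namespace Literature.Probability.RandomPlanarGeometry.SAW.HV

open HexBW.Arm

variable {y : ℝ}

/-- `C⁺_n(y) ≤ y^{(n-1)/2 + 2} · C⁺_n(1)` for `y ≥ 1` (through the dictionary `C⁺_{m+1} = C^w_m`; there is no walk with `0` vertices).
[cite: Beaton2014RotatedHoneycomb, §3.1 (arXiv v3 p. 11: C⁺_n(y)) and Proposition 7 (p. 11)] -/
theorem rotHpCoeff_le_pow_half_mul (hy : 1 ≤ y) (n : ℕ) : rotHpCoeff n y ≤ y ^ ((n - 1) / 2 + 2) * rotHpCoeff n 1 := by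
  rcases Nat.eq_zero_or_pos n with rfl | hn
  · -- no walk with `0` vertices
    have h0 : ∀ z : ℝ, rotHpCoeff 0 z = 0 := fun z => by
      rw [rotHpCoeff]; refine Finset.sum_eq_zero fun l hl => ?_
      obtain ⟨-, hh, -, hlen, -⟩ := mem_rotHpWalks_iff.1 hl
      rw [List.length_eq_zero_iff] at hlen; subst hlen; simp at hh
    rw [h0, h0, mul_zero]
  · obtain ⟨m, rfl⟩ : ∃ m, n = m + 1 := ⟨n - 1, by omega⟩
    rw [rotHpCoeff_succ_eq, rotHpCoeff_succ_eq, show (m + 1 - 1) / 2 = m / 2 by omega]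
    exact Cw_le_pow_mul hy m

/-- **`μ(y) ≤ √(max(1,y)) · μ` for every `y > 0`.** [cite: Beaton2014RotatedHoneycomb, §3.1, Proposition 7 (arXiv v3 p. 11: "1 ≤ y_c ≤ μ²")] -/
theorem rotSurfaceMu_le_sqrt_max_mul (hy : 0 < y) : rotSurfaceMu y ≤ Real.sqrt (max 1 y) * hexConnectiveConstant := by
  have hμ := hexConnectiveConstant_pos
  have h1 : 1 ≤ Real.sqrt (max 1 y) := by
    have h := Real.sqrt_le_sqrt (le_max_left (1 : ℝ) y); rwa [Real.sqrt_one] at h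
  unfold rotSurfaceMu
  exact max_le (armRate_le_sqrt_max_mul hy) (le_mul_of_one_le_left hμ.le h1)

/-- **`μ(y) ≤ √y · μ` for `y ≥ 1`** (`y² ≤ y_c μ²`-type bound behind Proposition 7's `y_c ≤ μ²`; the matching lower bound `μ(y) ≥ √y` is printed).
[cite: Beaton2014RotatedHoneycomb, §3.1, Proposition 7 (arXiv v3 p. 11: "μ(y) ≥ max{μ, √y}" and "1 ≤ y_c ≤ μ²")] -/
theorem rotSurfaceMu_le_sqrt_mul (hy : 1 ≤ y) : rotSurfaceMu y ≤ Real.sqrt y * hexConnectiveConstant := by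
  have h := rotSurfaceMu_le_sqrt_max_mul (lt_of_lt_of_le one_pos hy)
  rwa [max_eq_right hy] at h

/-- **Proposition 7, printed clause: "For `0 < y ≤ 1`, `μ(y) = μ(1) = μ`"** (`μ = √(2+√2)`, `= 1/x_c` in the tree's dictionary) — door-free,
in the dictionary form. [cite: Beaton2014RotatedHoneycomb, §3.1, Proposition 7 (arXiv p. 11: "For 0 < y ≤ 1, μ(y) = μ(1) = μ, where μ = √(2+√2) is the growth constant of SAWs on the honeycomb lattice")] -/
theorem rotSurfaceMu_eq_of_le_one (hy : 0 < y) (h1 : y ≤ 1) : rotSurfaceMu y = hexConnectiveConstant :=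
  max_eq_right (armRate_le_hexConnectiveConstant_of_le_one hy h1)

/-- `√y < μ(y)` for every `y > 0` (strict form of the printed `μ(y) ≥ √y`, via the tree's `√y < β_rot(y)`).
[cite: Beaton2014RotatedHoneycomb, §3.1, Proposition 7 (arXiv v3 p. 11: "μ(y) ≥ max{μ, √y}")] -/
theorem sqrt_lt_rotSurfaceMu (hy : 0 < y) : Real.sqrt y < rotSurfaceMu y :=
  (sqrt_lt_armRate hy).trans_le (armRate_le_rotSurfaceMu y)

/-- **Two-sided: `√y < μ(y) ≤ √y · μ` for every `y ≥ 1`.** [cite: Beaton2014RotatedHoneycomb, §3.1, Proposition 7 (arXiv v3 p. 11)] -/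
theorem sqrt_lt_rotSurfaceMu_le (hy : 1 ≤ y) : Real.sqrt y < rotSurfaceMu y ∧ rotSurfaceMu y ≤ Real.sqrt y * hexConnectiveConstant :=
  ⟨sqrt_lt_rotSurfaceMu (lt_of_lt_of_le one_pos hy), rotSurfaceMu_le_sqrt_mul hy⟩

/-! ### EDITION 4 — Beaton's argument for `y_c ≤ μ²`, door-free: above `μ²` the adsorbed regime has certainly begun -/

/-- **`μ < β_rot(y)` for every `y > μ²`** (door-free: `β_rot(y) > √y ≥ μ`). [cite: Beaton2014RotatedHoneycomb, §3.1, Proposition 7 (arXiv p. 11: "μ(y) ≥ max{μ, √y}. This implies the existence of a critical value y_c, with 1 ≤ y_c ≤ μ²")] -/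
theorem hexConnectiveConstant_lt_armRate_of_sq_lt (hy : hexConnectiveConstant ^ 2 < y) : hexConnectiveConstant < armRate y := by
  have hμ := hexConnectiveConstant_pos
  have hy0 : 0 < y := lt_trans (by positivity) hy
  calc hexConnectiveConstant = Real.sqrt (hexConnectiveConstant ^ 2) := (Real.sqrt_sq hμ.le).symm
    _ ≤ Real.sqrt y := Real.sqrt_le_sqrt hy.le
    _ < armRate y := sqrt_lt_armRate hy0

/-- **`μ < μ(y)` for every `y > μ²`** — the printed consequence "`y_c ≤ μ²`" in rate form, door-free (no limit theorem, no identity).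
[cite: Beaton2014RotatedHoneycomb, §3.1, Proposition 7 (arXiv p. 11: "This implies the existence of a critical value y_c, with 1 ≤ y_c ≤ μ²")] -/
theorem hexConnectiveConstant_lt_rotSurfaceMu_of_sq_lt (hy : hexConnectiveConstant ^ 2 < y) : hexConnectiveConstant < rotSurfaceMu y :=
  (hexConnectiveConstant_lt_armRate_of_sq_lt hy).trans_le (armRate_le_rotSurfaceMu y)

end Literature.Probability.RandomPlanarGeometry.SAW.HV
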